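import Summits.RiemannHypothesis.RiemannHypothesis.Theorems.JensenPolynomialsCapTailCaps
import Summits.RiemannHypothesis.RiemannHypothesis.Theorems.JensenPolynomialsCapCertTable

/-!
# Route `JensenPolynomials` — uniform tail of `XiCumulantMajorantCap(Far)`, part T3: table comparison and geometric envelope

The uniform tail (all `d ≥ D⋆ = 100` at once; see part T1 `JensenPolynomialsCapTailCompute` for the scheme and the
certificate `tailCheck`) of the crux children `XiCumulantMajorantCap` (stmt-RiemannHypothesis-19217) and
`XiCumulantMajorantCapFar` (stmt-RiemannHypothesis-19472) of route `JensenPolynomials` (rung J-P(P1′), cell rh-jensen,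
engine seat g4).  RH-FREE, γ-FREE: elementary arithmetic on a fixed majorant series — nothing here is a statement about `ξ`
or `ζ`, and nothing here bears on the truth of RH.  Every lemma is stated over VARIABLE data `(q, D, y, bts, T, C, J, …)` and is
instantiated at the certificate's constants only by `exact` in part T4 (no tactic ever unfolds a `2⁹⁶`-scale constant).

This part: the table comparison `ẽ_j ≤ ẽ⁺_j/ONE` for ANY list dominating `b̃` below `KK` and any `T` dominating the
`k`-tail (eng-2's `et_le_etU` argument, part 4 of the per-degree packaging, made generic); the `4^k`-weighted bound
`Σ b̃_{i+1}4^{i+1} ≤ GOf bts D y/ONE`; and the geometric envelope `ẽ_j ≤ (C/ONE)·(1/4)^j` for EVERY `j` by strong induction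
(it closes because the weighted sum is `≤ J + 1`), with `C⁺ = COf ets J` dominating the table.
-/

-- D-0017: `Summit.RiemannHypothesis.RiemannHypothesis.…` duplicates the namespace BY DESIGN (single-problem summit).
set_option linter.dupNamespace false

open Finset

namespace Summit.RiemannHypothesis.RiemannHypothesis.Theorems.JensenPolynomials.CapCert

noncomputable section

open Real
open Summit.RiemannHypothesis.RiemannHypothesis.Theorems.JensenPolynomials

/-! ## The table comparison `ẽ_j ≤ ẽ⁺_j/ONE` (eng-2's `et_le_etU` argument on an arbitrary dominating list) -/

/-- Generic form of the table comparison (adapted from `et_le_etU`, part 4 of the packaging): any list dominating `b̃`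
below `KK`, any `T` dominating the `k`-tail. -/
theorem et_le_etU_of (d : ℕ) (bts : List ℕ) (T : ℕ) (hle1 : ∀ j, et d j ≤ 1)
    (htail : ∀ n, ∑ i ∈ range n, (if KK ≤ i then bt d (i + 1) else 0) ≤ (T : ℝ) / ONE)
    (hbt : ∀ i, 2 ≤ i → i < KK → bt d (i + 1) ≤ (bts.getD (i - 2) 0 : ℝ) / ONE) :
    ∀ j, et d j ≤ (etU bts T j : ℝ) / ONE := by
  intro j
  induction j using Nat.strong_induction_on with
  | _ j ih =>
    cases j with
    | zero => rw [(cap_facts d).2.2.2.2, etU_zero, div_self ONE_facts.2.1]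
    | succ j =>
      rw [etU_succ]
      by_cases hj : j + 1 < 3
      · rw [if_pos hj, et_succ_small d j hj]; simp
      · rw [if_neg hj, et_succ]
        unfold etStep
        have hpos : (0 : ℝ) < (j : ℝ) + 1 := by positivity
        set F : ℕ → ℕ := fun i => if 2 ≤ i ∧ i < KK then bts.getD (i - 2) 0 * (etTab bts T j).getD i 0 else 0
          with hF
        have hterm : ∀ i ∈ range (j + 1), (if 2 ≤ i then bt d (i + 1) * et d (j - i) else 0)
            ≤ ((F i : ℕ) : ℝ) / ONE / ONE + (if KK ≤ i then bt d (i + 1) else 0) := by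
          intro i hi
          rw [Finset.mem_range] at hi
          by_cases h2 : 2 ≤ i
          · rw [if_pos h2]
            by_cases hK : i < KK
            · have hnK : ¬ KK ≤ i := by omega
              rw [if_neg hnK, add_zero, hF]
              simp only
              rw [if_pos ⟨h2, hK⟩, etTab_getD bts T j i (by omega)]
              push_cast
              have hb := hbt i h2 hK
              have he := ih (j - i) (by omega)
              calc bt d (i + 1) * et d (j - i)
                  ≤ (bts.getD (i - 2) 0 : ℝ) / ONE * ((etU bts T (j - i) : ℝ) / ONE) :=
                    mul_le_mul hb he (et_nonneg d _).1 ((bt_nonneg d _).1.trans hb)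
                _ = _ := by ring
            · have hKle : KK ≤ i := by omega
              have hn : ¬ (2 ≤ i ∧ i < KK) := fun h => hK h.2
              rw [if_pos hKle, hF]
              simp only
              rw [if_neg hn]
              push_cast
              rw [zero_div, zero_div, zero_add]
              have := hle1 (j - i)
              have hb := (bt_nonneg d (i + 1)).1
              calc bt d (i + 1) * et d (j - i) ≤ bt d (i + 1) * 1 := mul_le_mul_of_nonneg_left this hb
                _ = bt d (i + 1) := mul_one _
          · have hn : ¬ (2 ≤ i ∧ i < KK) := fun h => h2 h.1
            have hnK : ¬ KK ≤ i := by unfold KK; omega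
            rw [if_neg h2, hF]
            simp only
            rw [if_neg hn, if_neg hnK]
            simp
        have hsum := Finset.sum_le_sum hterm
        rw [Finset.sum_add_distrib, ← Finset.sum_div, ← Finset.sum_div, ← Nat.cast_sum] at hsum
        have htail' : ∑ i ∈ range (j + 1), (if KK ≤ i then bt d (i + 1) else 0)
            ≤ ((if KK < j + 1 then T * ONE else 0 : ℕ) : ℝ) / ONE / ONE := by
          by_cases hKj : KK < j + 1
          · rw [if_pos hKj]; push_cast; rw [mul_div_assoc, div_self ONE_facts.2.1, mul_one]
            exact htail (j + 1)
          · rw [if_neg hKj, Finset.sum_eq_zero (fun i hi => by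
                rw [Finset.mem_range] at hi
                rw [if_neg (by omega : ¬ KK ≤ i)])]
            simp
        set N : ℕ := (∑ i ∈ range (j + 1), F i) + (if KK < j + 1 then T * ONE else 0) with hN
        have key : (∑ i ∈ range (j + 1), (if 2 ≤ i then bt d (i + 1) * et d (j - i) else 0))
            ≤ (N : ℝ) / ONE / ONE := by
          rw [hN]; push_cast; rw [add_div, add_div]
          refine hsum.trans ?_
          push_cast at htail' ⊢
          linarith
        have hden : 0 < (j + 1) * ONE := Nat.mul_pos (Nat.succ_pos j) ONE_facts.2.2
        have hc := div_le_cdiv N ((j + 1) * ONE) hden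
        calc (∑ i ∈ range (j + 1), (if 2 ≤ i then bt d (i + 1) * et d (j - i) else 0)) / ((j : ℝ) + 1)
            ≤ ((N : ℝ) / ONE / ONE) / ((j : ℝ) + 1) := div_le_div_of_nonneg_right key hpos.le
          _ = ((N : ℝ) / (((j + 1) * ONE : ℕ) : ℝ)) / ONE := by
              have hO : (ONE : ℝ) ≠ 0 := ONE_facts.2.1
              push_cast; field_simp
          _ ≤ (cdiv N ((j + 1) * ONE) : ℝ) / ONE := div_le_div_of_nonneg_right hc ONE_facts.1.le

/-! ## The `j`-tail: `ẽ_j ≤ C·4^{−j}` for every `j` -/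

/-- `4^k`-weighted uniform sum: `Σ_{i<n, 2≤i} b̃_{i+1}4^{i+1} ≤ GOf bts D y/ONE` for all `d ≥ D`, for any list dominating
`b̃` below `KK` (given the `z`-ratio check `ypOfT (4y) < ONE`). -/
theorem sumG_le_of {D y d : ℕ} (bts : List ℕ) (hD : 0 < D) (hy : √8 / (D : ℝ) ≤ (y : ℝ) / ONE) (hd : D ≤ d)
    (hbt : ∀ i, 2 ≤ i → i < KK → bt d (i + 1) ≤ (bts.getD (i - 2) 0 : ℝ) / ONE)
    (hzp : ypOfT (4 * y) < ONE) (n : ℕ) :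
    ∑ i ∈ range n, (if 2 ≤ i then bt d (i + 1) * 4 ^ (i + 1) else 0) ≤ (GOf bts D y : ℝ) / ONE := by
  have hsplit : ∀ i ∈ range n, (if 2 ≤ i then bt d (i + 1) * 4 ^ (i + 1) else 0)
      = (if 2 ≤ i ∧ i < KK then bt d (i + 1) * 4 ^ (i + 1) else 0)
        + (if KK ≤ i then bt d (i + 1) * 4 ^ (i + 1) else 0) := by
    intro i _
    by_cases h2 : 2 ≤ i
    · by_cases hK : i < KK
      · rw [if_pos h2, if_pos ⟨h2, hK⟩, if_neg (by omega), add_zero]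
      · have hn : ¬ (2 ≤ i ∧ i < KK) := fun h => hK h.2
        rw [if_pos h2, if_neg hn, if_pos (by omega), zero_add]
    · have hn : ¬ (2 ≤ i ∧ i < KK) := fun h => h2 h.1
      rw [if_neg h2, if_neg hn, if_neg (by unfold KK; omega), add_zero]
  rw [Finset.sum_congr rfl hsplit, Finset.sum_add_distrib]
  unfold GOf
  push_cast
  rw [add_div]
  apply add_le_add
  · -- head: termwise against the list
    have key : ∑ i ∈ range n, (if 2 ≤ i ∧ i < KK then bt d (i + 1) * 4 ^ (i + 1) else 0)
        ≤ ∑ i ∈ range KK, (if 2 ≤ i ∧ i < KK then bt d (i + 1) * 4 ^ (i + 1) else 0) := by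
      rcases Nat.lt_or_ge KK n with h | h
      swap
      · exact Finset.sum_le_sum_of_subset_of_nonneg (Finset.range_mono h)
          (fun i _ _ => by split_ifs; exacts [mul_nonneg (bt_nonneg d _).1 (pow_nonneg (by norm_num) _), le_rfl])
      · rw [← Finset.sum_range_add_sum_Ico _ h.le]
        have : ∑ i ∈ Ico KK n, (if 2 ≤ i ∧ i < KK then bt d (i + 1) * 4 ^ (i + 1) else 0) = 0 :=
          Finset.sum_eq_zero (fun i hi => by rw [Finset.mem_Ico] at hi; rw [if_neg (by omega)])
        rw [this, add_zero]
    refine key.trans ?_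
    rw [Finset.sum_div]
    apply Finset.sum_le_sum
    intro i hi
    rw [Finset.mem_range] at hi
    by_cases h2 : 2 ≤ i
    · rw [if_pos ⟨h2, hi⟩, if_pos h2]
      have hb := hbt i h2 hi
      calc bt d (i + 1) * 4 ^ (i + 1) ≤ ((bts.getD (i - 2) 0 : ℕ) : ℝ) / ONE * 4 ^ (i + 1) :=
            mul_le_mul_of_nonneg_right hb (pow_nonneg (by norm_num) _)
        _ = _ := by ring
    · have hn : ¬ (2 ≤ i ∧ i < KK) := fun h => h2 h.1
      rw [if_neg hn, if_neg h2, zero_div]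
  · -- tail: geometric in z = 4y
    set w : ℝ := ((4 * y : ℕ) : ℝ) / ONE with hw_def
    have hw0 : 0 ≤ w := fp_nonneg (4 * y)
    have hw'1 := ratio_lt_one (4 * y) hzp
    have hc : (0 : ℝ) ≤ 16 * (D : ℝ) / 12 := by positivity
    have hzy : 4 * ((y : ℝ) / ONE) = w := by rw [hw_def]; push_cast; ring
    have ha : ∀ i, KK ≤ i → bt d (i + 1) * 4 ^ (i + 1) ≤ 16 * (D : ℝ) / 12 * ((i : ℝ) + 1) * w ^ (i - 1) := by
      intro i hi
      have hi3 : 3 ≤ i := by unfold KK at hi; omega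
      have h := bt_le_unif hD hy hd (by omega : 4 ≤ i + 1)
      have e : i + 1 - 2 = i - 1 := by omega
      rw [e] at h
      have h4 : (0 : ℝ) ≤ 4 ^ (i + 1) := pow_nonneg (by norm_num) _
      have := mul_le_mul_of_nonneg_right h h4
      refine this.trans (le_of_eq ?_)
      rw [← hzy]
      have e4 : (4 : ℝ) ^ (i + 1) = 16 * 4 ^ (i - 1) := by
        rw [show i + 1 = (i - 1) + 2 from by omega, pow_add]; ring
      rw [e4, mul_pow]
      push_cast
      ring
    refine (sum_ktail_le (fun k => bt d k * 4 ^ k) hc hw0 hw'1 ha n).trans ?_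
    have h1 : 16 * (D : ℝ) / 12 * ((KK : ℝ) + 1) ≤ (ofRatU (16 * D * (KK + 1)) 12 : ℝ) / ONE := by
      have := ofRatU_ge (16 * D * (KK + 1)) 12 (by norm_num)
      have e : 16 * (D : ℝ) / 12 * ((KK : ℝ) + 1) = ((16 * D * (KK + 1) : ℕ) : ℝ) / ((12 : ℕ) : ℝ) := by
        push_cast; ring
      rw [e]; exact this
    have h2 : w ^ (KK - 1) ≤ (powU (4 * y) (KK - 1) : ℝ) / ONE := powU_ge hw0 le_rfl _
    have hA0 : 0 ≤ 16 * (D : ℝ) / 12 * ((KK : ℝ) + 1) := by positivity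
    have key := fp_tail_compare hA0 (pow_nonneg hw0 _) h1 h2 hzp hw'1 (one_sub_ratio_ge (4 * y) hzp)
    calc 16 * (D : ℝ) / 12 * (((KK : ℝ) + 1) * w ^ (KK - 1)) * (1 / (1 - (((KK : ℝ) + 2) / ((KK : ℝ) + 1)) * w))
        = 16 * (D : ℝ) / 12 * ((KK : ℝ) + 1) * w ^ (KK - 1)
            * (1 / (1 - (((KK : ℝ) + 2) / ((KK : ℝ) + 1)) * w)) := by ring
      _ ≤ _ := key

/-- Entries of a reversed table of length `J + 1`: `(etTab bts T J)[J − j] = ẽ⁺_j`. -/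
theorem etTab_getD_rev (bts : List ℕ) (T J : ℕ) {j : ℕ} (hj : j ≤ J) :
    (etTab bts T J).getD (J - j) 0 = etU bts T j := by
  rw [etTab_getD bts T J (J - j) (by omega)]
  congr 1; omega

/-- **The geometric envelope (generic): `ẽ_j ≤ (C/ONE)·(1/4)^j` for EVERY `j`**, from a table bound `ẽ ≤ ẽ⁺/ONE`,
`C ≥ max_{j≤J} ẽ⁺_j 4^j`, and a `4^k`-weighted bound `J + 1` of the `b̃`-sums (`J ≥ 2`). -/
theorem et_le_geom_of {d : ℕ} (bts : List ℕ) (T C J : ℕ) (hJ : 2 ≤ J)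
    (hetU : ∀ j, et d j ≤ (etU bts T j : ℝ) / ONE)
    (hC : ∀ j, j ≤ J → etU bts T j * 4 ^ j ≤ C)
    (hGs : ∀ n, ∑ i ∈ range n, (if 2 ≤ i then bt d (i + 1) * 4 ^ (i + 1) else 0) ≤ (J : ℝ) + 1) :
    ∀ j, et d j ≤ (C : ℝ) / ONE * (1 / 4) ^ j := by
  have hC0 : 0 ≤ (C : ℝ) / ONE := fp_nonneg C
  intro j
  induction j using Nat.strong_induction_on with
  | _ j ih =>
    by_cases hj : j ≤ J
    · have h1 := hetU j
      have hC' : (etU bts T j : ℝ) * 4 ^ j ≤ (C : ℝ) := by exact_mod_cast hC j hj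
      have h4 : (0 : ℝ) < 4 ^ j := pow_pos (by norm_num) _
      calc et d j ≤ (etU bts T j : ℝ) / ONE := h1
        _ = (etU bts T j : ℝ) * 4 ^ j / ONE * (1 / 4) ^ j := by
            rw [one_div_pow]; field_simp
        _ ≤ (C : ℝ) / ONE * (1 / 4) ^ j := by
            apply mul_le_mul_of_nonneg_right _ (pow_nonneg (by norm_num) _)
            exact div_le_div_of_nonneg_right hC' ONE_facts.1.le
    · obtain ⟨j, rfl⟩ : ∃ i, j = i + 1 := ⟨j - 1, by omega⟩
      rw [et_succ]
      have hpos : (0 : ℝ) < (j : ℝ) + 1 := by positivity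
      have hq0 : (0 : ℝ) ≤ (1 / 4) ^ (j + 1) := pow_nonneg (by norm_num) _
      have hterm : ∀ i ∈ range (j + 1), (if 2 ≤ i then bt d (i + 1) * et d (j - i) else 0)
          ≤ (C : ℝ) / ONE * (1 / 4) ^ (j + 1) * (if 2 ≤ i then bt d (i + 1) * 4 ^ (i + 1) else 0) := by
        intro i hi
        rw [Finset.mem_range] at hi
        split_ifs with h2
        · have he := ih (j - i) (by omega)
          have hb := (bt_nonneg d (i + 1)).1
          calc bt d (i + 1) * et d (j - i) ≤ bt d (i + 1) * ((C : ℝ) / ONE * (1 / 4) ^ (j - i)) :=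
                mul_le_mul_of_nonneg_left he hb
            _ = (C : ℝ) / ONE * (1 / 4) ^ (j + 1) * (bt d (i + 1) * 4 ^ (i + 1)) := by
                have e : (1 / 4 : ℝ) ^ (j - i) = (1 / 4) ^ (j + 1) * 4 ^ (i + 1) := by
                  rw [show j + 1 = (j - i) + (i + 1) from by omega, pow_add, one_div_pow, one_div_pow]
                  field_simp
                rw [e]; ring
        · simp
      have hsum1 := Finset.sum_le_sum hterm
      rw [← Finset.mul_sum] at hsum1
      have hsum := hsum1.trans (mul_le_mul_of_nonneg_left (hGs (j + 1)) (mul_nonneg hC0 hq0))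
      rw [div_le_iff₀ hpos]
      refine hsum.trans ?_
      have hj' : (J : ℝ) + 1 ≤ (j : ℝ) + 1 := by
        have : J + 1 ≤ j + 1 := by omega
        exact_mod_cast this
      exact mul_le_mul_of_nonneg_left hj' (mul_nonneg hC0 hq0)

/-- `C⁺ = COf ets J` dominates every `ets[J − j]·4^j`, `j ≤ J`. -/
theorem le_COf (ets : List ℕ) (J : ℕ) {j : ℕ} (hj : j ≤ J) : ets.getD (J - j) 0 * 4 ^ j ≤ COf ets J := by
  unfold COf
  have key : ∀ (l : List ℕ) (a : ℕ), a ∈ l → a ≤ lmax l := by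
    intro l
    induction l with
    | nil => intro a h; simp at h
    | cons b l ih =>
      intro a h
      simp only [lmax, List.foldr_cons]
      rcases List.mem_cons.mp h with rfl | h'
      · exact le_max_left _ _
      · exact (ih a h').trans (le_max_right _ _)
  exact key _ _ (List.mem_map.mpr ⟨j, List.mem_range.mpr (by omega), rfl⟩)

end

end Summit.RiemannHypothesis.RiemannHypothesis.Theorems.JensenPolynomials.CapCert
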